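import Literature.Computability.Cryptography.GGMSimulatorSpec
import Literature.Computability.Complexity.MapAnswers
import Literature.Computability.Complexity.LazySamplingMachine
import Literature.Computability.Complexity.UnaryBricks
import Literature.Computability.Complexity.HashBricks
import HarnessLib

/-!
# The GGM hybrid argument, IV: the simulator is polynomial time (`GGMHyb.distinguisher` is PPT)

Topic `Literature/Computability/Cryptography`; fourth companion file of `GGM.lean` towards the
discharge of `Literature.Computability.Cryptography.GGM1986_thm3`. `GGMSimulatorSpec.lean`
specifies Goldreich's distinguisher `D` (2001, proof of Thm. 3.6.6, p. 188: "Clearly, algorithm `D`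
can be implemented in polynomial time") as a function of its deterministic input
`w = ⟨⟨1ⁿ, s⟩, r⟩`; here its running time is established on Mathlib's TM2 model, in the
transcript model of oracle computation and with the tree's toolkits — no Turing machine is
written:

* **the simulated oracle as an `FP` string function** `GGMHyb.hOracle 𝒜 G` answering a query
  record `⟨w, ⟨listBool E', u⟩⟩` (input, outer transcript, query) by `⟨answer, u⟩` — the answer
  followed by an ECHO of the query, so that the history of queries travels in the transcript
  (the device of Bennett–Gill's simulator, `Complexity/LazySamplingMachine.lean`); the answer is
  the round-indexed lazy rule of `GGMHybridRuns.lean`: scan the echoed queries for the first one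
  with the same level-`i` prefix (`Brick.foldFn` over the coded transcript), take the value of
  that round (`valL`: block / sample / `G` of a half block, by unary comparisons), walk down the
  tree (`GGM.evalFn` of `GGM.lean`); `hOracle_apply` is its value on every record;
* **the simulator** `GGMHyb.sim 𝒜 = (((𝒜.alg.clockFst 𝒜.fuel false).mapAnswers fstF).comap aInF).mapQuery id`
  — the adversary, clocked by its own round budget, reading the first component of each answer
  (`OracleAlg.mapAnswers`, `Complexity/MapAnswers.lean`), run on `⟨1ⁿ, r_A⟩` parsed from `w`
  (`comap`), announcing input and transcript with each query (`mapQuery`); polynomial time by the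
  toolkit's `isPolyTime_*`; **semantics** `run_sim`: against `hOracle` its run is the rule-run
  `runRule` of `simRule` (the echo invariant `echoT`);
* `simLang_mem_PRel`, `simLang_mem_P` — the simulation language is in `P^{hOracle} ⊆ P^{FP} ⊆ P`
  (`OracleAlg.PRel_subset_PRel_of_mem_FPRel`, `PRel_empty_holds`), with the polynomial
  `simPolyGGM` bounding rounds and the size of query records;
* `distinguisher_isPPT` — `D` is PPT: its verdict is the guard bit `[i < n ∧ j < t]` (an `FP`
  one-bit brick) AND the indicator of `simLang` (in `P`), its coin budget a polynomial.

## References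

* O. Goldreich, *Foundations of Cryptography I*, CUP 2001, proof of Thm. 3.6.6, p. 188–189
  ("Clearly, algorithm `D` can be implemented in polynomial time").
* O. Goldreich, S. Goldwasser, S. Micali, J. ACM 33 (1986), p. 801 (the test `A_T` is a
  "polynomial-time statistical test for strings").
* S. Arora, B. Barak, *Computational Complexity: A Modern Approach*, CUP 2009, §3.4, §1.3.
-/

noncomputable section

namespace Literature.Computability.Cryptography

open _root_.Computability Complexity Complexity.OracleAlg Complexity.Brick Complexity.Plumb
  Complexity.HashBricks Polynomial

namespace GGMHyb

variable (𝒜 : OracleAdversary Bool) (G : List Bool → List Bool)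

/-! ### The parameters of the simulation as string functions of `w` -/

section Params

/-- The string `fst (fst w)` (on a genuine input `1ⁿ`); only its length `nOf w` is ever used. [folklore] -/
def nSF : List Bool → List Bool := fstF ∘ fstF

/-- `|nSF w| = nOf w`. [folklore] -/
@[simp] theorem length_nSF (w : List Bool) : (nSF w).length = nOf w := rfl

/-- `nSF ∈ FP`. [folklore] -/
theorem nSF_mem_FP : nSF ∈ FP := comp_mem_FP fstF_mem_FP fstF_mem_FP

/-- `1^{2n}`. [folklore] -/
def twoNF : List Bool → List Bool := fun w => nSF w ++ nSF w

/-- `|twoNF w| = 2 nOf w`. [folklore] -/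
@[simp] theorem length_twoNF (w : List Bool) : (twoNF w).length = 2 * nOf w := by
  simp [twoNF, two_mul]

/-- `twoNF ∈ FP`. [folklore] -/
theorem twoNF_mem_FP : twoNF ∈ FP := append_mem_FP nSF_mem_FP nSF_mem_FP

/-- The sample `sOf w` as a string function. [folklore] -/
def sSF : List Bool → List Bool := takeFn ∘ fanoutFn twoNF (sndF ∘ fstF)

/-- `sSF w = sOf w`. [folklore] -/
@[simp] theorem sSF_apply (w : List Bool) : sSF w = sOf w := by
  simp [sSF, sOf, fanoutFn_apply]

/-- `sSF ∈ FP`. [folklore] -/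
theorem sSF_mem_FP : sSF ∈ FP :=
  comp_mem_FP takeFn_mem_FP (fanoutFn_mem_FP twoNF_mem_FP (comp_mem_FP sndF_mem_FP fstF_mem_FP))

/-- `1^{t}`, `t = fuel(n)`. [folklore] -/
def tUF : List Bool → List Bool := polyFn 𝒜.fuel ∘ nSF

/-- `tUF w = 1^{tA n}`. [folklore] -/
@[simp] theorem tUF_apply (w : List Bool) : tUF 𝒜 w = ones (tA 𝒜 (nOf w)) := by
  simp [tUF, tA]

/-- `tUF ∈ FP`. [folklore] -/
theorem tUF_mem_FP : tUF 𝒜 ∈ FP := comp_mem_FP (polyFn_mem_FP _) nSF_mem_FP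

/-- `1^{coins(n)}`. [folklore] -/
def cUF : List Bool → List Bool := polyFn 𝒜.coins ∘ nSF

/-- `cUF w = 1^{cA n}`. [folklore] -/
@[simp] theorem cUF_apply (w : List Bool) : cUF 𝒜 w = ones (cA 𝒜 (nOf w)) := by
  simp [cUF, cA]

/-- `cUF ∈ FP`. [folklore] -/
theorem cUF_mem_FP : cUF 𝒜 ∈ FP := comp_mem_FP (polyFn_mem_FP _) nSF_mem_FP

/-- `1^{α}`, `α = ⌊log₂ n⌋ + 1`. [folklore] -/
def alphaUF : List Bool → List Bool := List.cons true ∘ logFn ∘ nSF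

/-- `alphaUF w = 1^{alphaOf n}`. [folklore] -/
@[simp] theorem alphaUF_apply (w : List Bool) : alphaUF w = ones (alphaOf (nOf w)) := by
  simp [alphaUF, alphaOf, logFn, ones, List.replicate_succ]

/-- `alphaUF ∈ FP`. [folklore] -/
theorem alphaUF_mem_FP : alphaUF ∈ FP := comp_mem_FP (cons_mem_FP true) (comp_mem_FP logFn_mem_FP nSF_mem_FP)

/-- `1^{β}`, `β = ⌊log₂ t⌋ + 1`. [folklore] -/
def betaUF : List Bool → List Bool := List.cons true ∘ logFn ∘ tUF 𝒜

/-- `betaUF w = 1^{betaOf t}`. [folklore] -/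
@[simp] theorem betaUF_apply (w : List Bool) : betaUF 𝒜 w = ones (betaOf (tA 𝒜 (nOf w))) := by
  simp [betaUF, betaOf, logFn, ones, List.replicate_succ]

/-- `betaUF ∈ FP`. [folklore] -/
theorem betaUF_mem_FP : betaUF 𝒜 ∈ FP := comp_mem_FP (cons_mem_FP true) (comp_mem_FP logFn_mem_FP (tUF_mem_FP 𝒜))

/-- The coins after the adversary's: `r ⇂ coins(n)`. [folklore] -/
def r1F : List Bool → List Bool := dropFn ∘ fanoutFn (cUF 𝒜) sndF

/-- Value of `r1F`. [folklore] -/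
@[simp] theorem r1F_apply (w : List Bool) : r1F 𝒜 w = (sndF w).drop (cA 𝒜 (nOf w)) := by
  simp [r1F, fanoutFn_apply, ones]

/-- `r1F ∈ FP`. [folklore] -/
theorem r1F_mem_FP : r1F 𝒜 ∈ FP := comp_mem_FP dropFn_mem_FP (fanoutFn_mem_FP (cUF_mem_FP 𝒜) sndF_mem_FP)

/-- The level bits. [folklore] -/
def aBitsF : List Bool → List Bool := takeFn ∘ fanoutFn alphaUF (r1F 𝒜)

/-- `aBitsF w = aBitsOf w`. [folklore] -/
@[simp] theorem aBitsF_apply (w : List Bool) : aBitsF 𝒜 w = aBitsOf 𝒜 w := by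
  simp [aBitsF, aBitsOf, fanoutFn_apply, ones]

/-- `aBitsF ∈ FP`. [folklore] -/
theorem aBitsF_mem_FP : aBitsF 𝒜 ∈ FP := comp_mem_FP takeFn_mem_FP (fanoutFn_mem_FP alphaUF_mem_FP (r1F_mem_FP 𝒜))

/-- The coins after the level bits. [folklore] -/
def r2F : List Bool → List Bool := dropFn ∘ fanoutFn alphaUF (r1F 𝒜)

/-- Value of `r2F`. [folklore] -/
@[simp] theorem r2F_apply (w : List Bool) : r2F 𝒜 w = ((sndF w).drop (cA 𝒜 (nOf w))).drop (alphaOf (nOf w)) := by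
  simp [r2F, fanoutFn_apply, ones]

/-- `r2F ∈ FP`. [folklore] -/
theorem r2F_mem_FP : r2F 𝒜 ∈ FP := comp_mem_FP dropFn_mem_FP (fanoutFn_mem_FP alphaUF_mem_FP (r1F_mem_FP 𝒜))

/-- The slot bits. [folklore] -/
def bBitsF : List Bool → List Bool := takeFn ∘ fanoutFn (betaUF 𝒜) (r2F 𝒜)

/-- `bBitsF w = bBitsOf w`. [folklore] -/
@[simp] theorem bBitsF_apply (w : List Bool) : bBitsF 𝒜 w = bBitsOf 𝒜 w := by
  simp [bBitsF, bBitsOf, fanoutFn_apply, ones]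

/-- `bBitsF ∈ FP`. [folklore] -/
theorem bBitsF_mem_FP : bBitsF 𝒜 ∈ FP := comp_mem_FP takeFn_mem_FP (fanoutFn_mem_FP (betaUF_mem_FP 𝒜) (r2F_mem_FP 𝒜))

/-- The block coins. [folklore] -/
def rFF : List Bool → List Bool := dropFn ∘ fanoutFn (betaUF 𝒜) (r2F 𝒜)

/-- `rFF w = rFOf w`. [folklore] -/
@[simp] theorem rFF_apply (w : List Bool) : rFF 𝒜 w = rFOf 𝒜 w := by
  simp [rFF, rFOf, fanoutFn_apply, ones]

/-- `rFF ∈ FP`. [folklore] -/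
theorem rFF_mem_FP : rFF 𝒜 ∈ FP := comp_mem_FP dropFn_mem_FP (fanoutFn_mem_FP (betaUF_mem_FP 𝒜) (r2F_mem_FP 𝒜))

/-- `1^{i}`, `i = min ⟦a⟧ n` (bounded binary-to-unary conversion against the ruler `nSF`). [folklore] -/
def iUF : List Bool → List Bool := binToUnaryFn ∘ fanoutFn nSF (aBitsF 𝒜)

/-- `iUF w = 1^{iOf w}`. [folklore] -/
@[simp] theorem iUF_apply (w : List Bool) : iUF 𝒜 w = ones (iOf 𝒜 w) := by
  simp [iUF, iOf, fanoutFn_apply]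

/-- `iUF ∈ FP`. [folklore] -/
theorem iUF_mem_FP : iUF 𝒜 ∈ FP := comp_mem_FP binToUnaryFn_mem_FP (fanoutFn_mem_FP nSF_mem_FP (aBitsF_mem_FP 𝒜))

/-- `1^{j}`, `j = min ⟦b⟧ t` (conversion against the ruler `tUF`). [folklore] -/
def jUF : List Bool → List Bool := binToUnaryFn ∘ fanoutFn (tUF 𝒜) (bBitsF 𝒜)

/-- `jUF w = 1^{jOf w}`. [folklore] -/
@[simp] theorem jUF_apply (w : List Bool) : jUF 𝒜 w = ones (jOf 𝒜 w) := by
  simp [jUF, jOf, fanoutFn_apply, ones]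

/-- `jUF ∈ FP`. [folklore] -/
theorem jUF_mem_FP : jUF 𝒜 ∈ FP := comp_mem_FP binToUnaryFn_mem_FP (fanoutFn_mem_FP (tUF_mem_FP 𝒜) (bBitsF_mem_FP 𝒜))

end Params

/-! ### Unary comparisons -/

section Unary

/-- `⟦1ᵃ⟧ < ⟦1ᵇ⟧ ↔ a < b` (the binary value of a unary numeral is `2ᵃ − 1`). [folklore] -/
theorem bitsToNat_ones_lt_iff (a b : ℕ) : bitsToNat (ones a) < bitsToNat (ones b) ↔ a < b := by
  rw [bitsToNat_ones, bitsToNat_ones]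
  have h1 : 1 ≤ 2 ^ a := Nat.one_le_two_pow
  have h2 : 1 ≤ 2 ^ b := Nat.one_le_two_pow
  constructor
  · intro h
    exact (Nat.pow_lt_pow_iff_right (by norm_num : 1 < 2)).1 (by omega)
  · intro h
    have := Nat.pow_lt_pow_right (by norm_num : 1 < 2) h
    omega

/-- `1ᵃ = 1ᵇ ↔ a = b`. [folklore] -/
theorem ones_eq_ones_iff (a b : ℕ) : ones a = ones b ↔ a = b :=
  ⟨fun h => by simpa [ones] using congrArg List.length h, fun h => h ▸ rfl⟩

/-- The bit read at a unary position is `getD`. [folklore] -/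
theorem headD_take_one_drop (u : List Bool) (i : ℕ) : ((u.drop i).take 1).headD false = u.getD i false := by
  rw [List.getD_eq_getElem?_getD]
  by_cases h : i < u.length
  · rw [List.take_one_drop_eq_of_lt_length h, List.getElem?_eq_getElem h]
    rfl
  · push Not at h
    rw [List.drop_eq_nil_of_le h, List.getElem?_eq_none h]
    rfl

/-- Equality of lengths as a one-bit test: `⟨a, b⟩ ↦ [|a| = |b|]`. [folklore] -/
def eqLenFn : List Bool → List Bool := eqPairFn ∘ fanoutFn (onesFn ∘ fstF) (onesFn ∘ sndF)

/-- Value of the length test. [folklore] -/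
@[simp] theorem eqLenFn_boolPair (a b : List Bool) : eqLenFn (boolPair a b) = [decide (a.length = b.length)] := by
  simp only [eqLenFn, Function.comp_apply, fanoutFn_apply, fstF_boolPair, sndF_boolPair, eqPairFn_boolPair, onesFn,
    OracleCompose.unaryEncodeNat_eq_replicate, ones_eq_ones_iff]

/-- `eqLenFn ∈ FP`. [folklore] -/
theorem eqLenFn_mem_FP : eqLenFn ∈ FP :=
  comp_mem_FP eqPairFn_mem_FP (fanoutFn_mem_FP (comp_mem_FP onesFn_mem_FP fstF_mem_FP) (comp_mem_FP onesFn_mem_FP sndF_mem_FP))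

/-- The length test is one-bit. [folklore] -/
theorem oneBit_eqLenFn : OneBit eqLenFn := fun z => by
  unfold eqLenFn
  rcases eqPairFn_eq_or (fanoutFn (onesFn ∘ fstF) (onesFn ∘ sndF) z) with h | h <;> exact ⟨_, h⟩

/-- The string equality test is one-bit. [folklore] -/
theorem oneBit_eqPairFn' : OneBit eqPairFn := fun z => by
  rcases eqPairFn_eq_or z with h | h <;> exact ⟨_, h⟩

end Unary

/-! ### The scan of the echoed queries: the first round with the same level-`i` vertex -/

section Scan

/-- **Does the echoed query `q = sndF e` of a transcript item have the current vertex?** —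
`[|q| = n ∧ q ↾ i = u ↾ i]`. [Goldreich 2001, p. 188 ("checking to see if its `k`-bit-long prefix
equals the `k`-bit-long prefix of a previous query")] [folklore] -/
def matchE (w u e : List Bool) : Bool :=
  decide ((sndF e).length = nOf w ∧ (sndF e).take (iOf 𝒜 w) = u.take (iOf 𝒜 w))

/-- **The round of the vertex**: the first item of the (echo) transcript whose query has the
current vertex, or the current round `|E'|` if there is none. [Goldreich 2001, p. 189] [folklore] -/
def kStar (w : List Bool) (E' : List (List Bool)) (u : List Bool) : ℕ := E'.findIdx (matchE 𝒜 w u)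

/-- The round of the vertex is at most the current round. [folklore] -/
theorem kStar_le (w : List Bool) (E' : List (List Bool)) (u : List Bool) : kStar 𝒜 w E' u ≤ E'.length :=
  List.findIdx_le_length

/-- The accumulator of the scan from flag `f` and count `c`: `⟨[f], 1ᶜ⟩`. [folklore] -/
def scanAcc (f : Bool) (c : ℕ) : List Bool := boolPair [f] (ones c)

/-- Fields of the scan's step argument `z = ⟨⟨P, L⟩, ⟨e, acc⟩⟩`, `P = ⟨nS, ⟨iU, key⟩⟩`: the
parameter record. [folklore] -/
def zP : List Bool → List Bool := fstF ∘ fstF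

/-- The echoed query of the item. [folklore] -/
def zQ : List Bool → List Bool := sndF ∘ nthF 1

/-- Test 1: `[|q| = |nS|]`. [folklore] -/
def m1F : List Bool → List Bool := eqLenFn ∘ fanoutFn zQ (fstF ∘ zP)

/-- Test 2: `[q ↾ |iU| = key]`. [folklore] -/
def m2F : List Bool → List Bool := eqPairFn ∘ fanoutFn (takeFn ∘ fanoutFn (nthF 1 ∘ zP) zQ) (sndPow 1 ∘ zP)

/-- The old flag bit. [folklore] -/
def foundF : List Bool → List Bool := headBitFn ∘ fstF ∘ sndPow 1

/-- The new flag: old flag or both tests. [folklore] -/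
def found'F : List Bool → List Bool := orFn foundF (andFn m1F m2F)

/-- The new count: frozen once found, else incremented. [folklore] -/
def fix'F : List Bool → List Bool := iteFn found'F (sndF ∘ sndPow 1) (List.cons true ∘ sndF ∘ sndPow 1)

/-- **The scan step.** [folklore] -/
def scanStep : List Bool → List Bool := fanoutFn found'F fix'F

/-- `m1F ∈ FP`. [folklore] -/
theorem m1F_mem_FP : m1F ∈ FP :=
  comp_mem_FP eqLenFn_mem_FP (fanoutFn_mem_FP (comp_mem_FP sndF_mem_FP (nthF_mem_FP 1))
    (comp_mem_FP fstF_mem_FP (comp_mem_FP fstF_mem_FP fstF_mem_FP)))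

/-- `m2F ∈ FP`. [folklore] -/
theorem m2F_mem_FP : m2F ∈ FP :=
  comp_mem_FP eqPairFn_mem_FP (fanoutFn_mem_FP
    (comp_mem_FP takeFn_mem_FP (fanoutFn_mem_FP (comp_mem_FP (nthF_mem_FP 1) (comp_mem_FP fstF_mem_FP fstF_mem_FP))
      (comp_mem_FP sndF_mem_FP (nthF_mem_FP 1))))
    (comp_mem_FP (sndPow_mem_FP 1) (comp_mem_FP fstF_mem_FP fstF_mem_FP)))

/-- `foundF ∈ FP`. [folklore] -/
theorem foundF_mem_FP : foundF ∈ FP := comp_mem_FP headBitFn_mem_FP (comp_mem_FP fstF_mem_FP (sndPow_mem_FP 1))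

/-- `found'F ∈ FP`. [folklore] -/
theorem found'F_mem_FP : found'F ∈ FP := orFn_mem_FP foundF_mem_FP (andFn_mem_FP m1F_mem_FP m2F_mem_FP)

/-- `fix'F ∈ FP`. [folklore] -/
theorem fix'F_mem_FP : fix'F ∈ FP :=
  iteFn_mem_FP found'F_mem_FP (comp_mem_FP sndF_mem_FP (sndPow_mem_FP 1))
    (comp_mem_FP (cons_mem_FP true) (comp_mem_FP sndF_mem_FP (sndPow_mem_FP 1)))

/-- `scanStep ∈ FP`. [folklore] -/
theorem scanStep_mem_FP : scanStep ∈ FP := fanoutFn_mem_FP found'F_mem_FP fix'F_mem_FP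

/-- The tests and flags are one-bit. [folklore] -/
theorem oneBit_found'F : OneBit found'F :=
  oneBit_orFn (oneBit_headBitFn.comp _) (oneBit_andFn (oneBit_eqLenFn.comp _) (oneBit_eqPairFn'.comp _))

/-- **Growth of the scan step**: the flag is one symbol, the count grows by at most one. [folklore] -/
theorem foldGrowth_scanStep : FoldGrowth 5 scanStep := fun z => by
  obtain ⟨b, hb⟩ := oneBit_found'F z
  unfold scanStep
  rw [fanoutFn_apply, length_boolPair, hb]
  have hfix : (fix'F z).length ≤ (sndF (sndPow 1 z)).length + 1 := by
    unfold fix'F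
    rw [iteFn_apply hb]
    cases b <;> simp
  have h1 : (sndF (sndPow 1 z)).length ≤ (sndPow 1 z).length := by
    have := length_fstF_sndF_le (sndPow 1 z); omega
  have e1 : sndPow 1 z = sndF (sndF z) := rfl
  rw [e1] at hfix h1
  simp only [List.length_singleton]
  omega

/-- **Value of the scan step** on a step argument with a well-formed accumulator. [folklore] -/
theorem scanStep_apply (nS iU key L e : List Bool) (f : Bool) (c : ℕ) :
    scanStep (boolPair (boolPair (boolPair nS (boolPair iU key)) L) (boolPair e (scanAcc f c))) =
      scanAcc (f || decide ((sndF e).length = nS.length ∧ (sndF e).take iU.length = key))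
        (if (f || decide ((sndF e).length = nS.length ∧ (sndF e).take iU.length = key)) then c else c + 1) := by
  set z := boolPair (boolPair (boolPair nS (boolPair iU key)) L) (boolPair e (scanAcc f c)) with hz
  have hm1 : m1F z = [decide ((sndF e).length = nS.length)] := by
    simp [m1F, zQ, zP, hz, fanoutFn_apply, nthF, scanAcc]
  have hm2 : m2F z = [decide ((sndF e).take iU.length = key)] := by
    simp [m2F, zQ, zP, hz, fanoutFn_apply, nthF, sndPow, scanAcc, eqPairFn_boolPair]
  have hfo : foundF z = [f] := by
    simp [foundF, hz, sndPow, scanAcc]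
  have hf' : found'F z = [f || decide ((sndF e).length = nS.length ∧ (sndF e).take iU.length = key)] := by
    unfold found'F
    rw [orFn_apply hfo (andFn_apply hm1 hm2)]
    simp only [Bool.decide_and]
  have hfix : sndF (sndPow 1 z) = ones c := by simp [hz, sndPow, scanAcc]
  unfold scanStep
  rw [fanoutFn_apply, hf']
  unfold fix'F scanAcc
  rw [iteFn_apply hf']
  simp only [Function.comp_apply, hfix]
  split_ifs <;> rfl

/-- **The scan computes the first matching index**: the left fold of the step over a list of
items from `⟨[f], 1ᶜ⟩`. [folklore] -/
theorem foldl_scanStep (nS iU key L : List Bool) (m : List Bool → Bool)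
    (hm : ∀ e, m e = decide ((sndF e).length = nS.length ∧ (sndF e).take iU.length = key)) :
    ∀ (l : List (List Bool)) (f : Bool) (c : ℕ),
      l.foldl (fun acc e => scanStep (boolPair (boolPair (boolPair nS (boolPair iU key)) L) (boolPair e acc)))
          (scanAcc f c) =
        scanAcc (f || l.any m) (if f then c else c + l.findIdx m)
  | [], f, c => by cases f <;> simp
  | e :: l, f, c => by
    rw [List.foldl_cons, scanStep_apply, ← hm e, foldl_scanStep nS iU key L m hm l]
    rw [List.any_cons, List.findIdx_cons]
    cases f
    · cases hme : m e
      · simp [Nat.add_assoc, Nat.add_comm 1]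
      · simp
    · simp

end Scan

/-! ### The simulated oracle -/

section Oracle

/-- **The answer of the simulated oracle** (specification): on input `w`, echo transcript `E'` and
query `u`, an invalid query gets `ε`, a valid one the walk from the value `valL` of the round
`kStar` of its level-`i` vertex. [Goldreich 2001, p. 188; GGM 1986, p. 801] [folklore] -/
def hAns (w : List Bool) (E' : List (List Bool)) (u : List Bool) : List Bool :=
  if u.length = nOf w then
    postPairL G (nOf w) (iOf 𝒜 w) (valL G (nOf w) (jOf 𝒜 w) (sOf w) (rFOf 𝒜 w) (kStar 𝒜 w E' u)) u
  else []

/-- The fields of a query record `v = ⟨w, ⟨C, u⟩⟩`: the input `w`. [folklore] -/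
def vW : List Bool → List Bool := fstF
/-- The coded outer transcript `C` of a query record. [folklore] -/
def vC : List Bool → List Bool := nthF 1
/-- The query `u` of a query record. [folklore] -/
def vU : List Bool → List Bool := sndPow 1

/-- The key `u ↾ i`. [folklore] -/
def keyF : List Bool → List Bool := takeFn ∘ fanoutFn (iUF 𝒜 ∘ vW) vU

/-- Value of the key. [folklore] -/
@[simp] theorem keyF_apply (v : List Bool) : keyF 𝒜 v = (vU v).take (iOf 𝒜 (vW v)) := by
  simp [keyF, fanoutFn_apply, ones]

/-- `keyF ∈ FP`. [folklore] -/
theorem keyF_mem_FP : keyF 𝒜 ∈ FP :=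
  comp_mem_FP takeFn_mem_FP (fanoutFn_mem_FP (comp_mem_FP (iUF_mem_FP 𝒜) fstF_mem_FP) (sndPow_mem_FP 1))

/-- The input of the scan: `⟨⟨nS, ⟨iU, key⟩⟩, encList E'⟩`. [folklore] -/
def scanInF : List Bool → List Bool :=
  fanoutFn (fanoutFn (nSF ∘ vW) (fanoutFn (iUF 𝒜 ∘ vW) (keyF 𝒜))) (sndF ∘ vC)

/-- `scanInF ∈ FP`. [folklore] -/
theorem scanInF_mem_FP : scanInF 𝒜 ∈ FP :=
  fanoutFn_mem_FP (fanoutFn_mem_FP (comp_mem_FP nSF_mem_FP fstF_mem_FP)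
    (fanoutFn_mem_FP (comp_mem_FP (iUF_mem_FP 𝒜) fstF_mem_FP) (keyF_mem_FP 𝒜))) (comp_mem_FP sndF_mem_FP (nthF_mem_FP 1))

/-- **The round of the vertex, in unary**: the count of the scan. [folklore] -/
def kUF : List Bool → List Bool := sndF ∘ foldFn scanStep (fun _ => scanAcc false 0) ∘ scanInF 𝒜

/-- `kUF ∈ FP`. [folklore] -/
theorem kUF_mem_FP : kUF 𝒜 ∈ FP :=
  comp_mem_FP sndF_mem_FP (comp_mem_FP (foldFn_mem_FP scanStep_mem_FP (const_mem_FP _) foldGrowth_scanStep)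
    (scanInF_mem_FP 𝒜))

/-- **Value of the scan**: `kUF v = 1^{k*}`, `k*` the first matching item of the decoded transcript. [folklore] -/
theorem kUF_apply (v : List Bool) : kUF 𝒜 v = ones (kStar 𝒜 (vW v) (decNil (sndF (vC v))) (vU v)) := by
  simp only [kUF, scanInF, Function.comp_apply, fanoutFn_apply, foldFn_boolPair]
  rw [foldl_scanStep (nSF (vW v)) (iUF 𝒜 (vW v)) (keyF 𝒜 v) (sndF (vC v)) (matchE 𝒜 (vW v) (vU v))
    (fun e => by simp [matchE, ones])]
  simp [scanAcc, kStar]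

/-- The value fields: `1^{2n}`, `1^{k*}`, the block coins. [folklore] -/
def blkF : List Bool → List Bool :=
  takeFn ∘ fanoutFn (twoNF ∘ vW) (dropFn ∘ fanoutFn (umulFn ∘ fanoutFn (twoNF ∘ vW) (kUF 𝒜)) (rFF 𝒜 ∘ vW))

/-- **`blkF v = blkL n r_F k*`.** [folklore] -/
theorem blkF_apply (v : List Bool) :
    blkF 𝒜 v = blkL (nOf (vW v)) (rFOf 𝒜 (vW v)) (kStar 𝒜 (vW v) (decNil (sndF (vC v))) (vU v)) := by
  simp [blkF, blkL, fanoutFn_apply, kUF_apply, umulFn_apply, ones]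

/-- `blkF ∈ FP`. [folklore] -/
theorem blkF_mem_FP : blkF 𝒜 ∈ FP :=
  comp_mem_FP takeFn_mem_FP (fanoutFn_mem_FP (comp_mem_FP twoNF_mem_FP fstF_mem_FP)
    (comp_mem_FP dropFn_mem_FP (fanoutFn_mem_FP
      (comp_mem_FP umulFn_mem_FP (fanoutFn_mem_FP (comp_mem_FP twoNF_mem_FP fstF_mem_FP) (kUF_mem_FP 𝒜)))
      (comp_mem_FP (rFF_mem_FP 𝒜) fstF_mem_FP))))

/-- `[k* < j]`. [folklore] -/
def ltJF : List Bool → List Bool := ltFn ∘ fanoutFn (kUF 𝒜) (jUF 𝒜 ∘ vW)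

/-- `[k* = j]`. [folklore] -/
def eqJF : List Bool → List Bool := eqPairFn ∘ fanoutFn (kUF 𝒜) (jUF 𝒜 ∘ vW)

/-- Value of `ltJF`. [folklore] -/
theorem ltJF_apply (v : List Bool) :
    ltJF 𝒜 v = [decide (kStar 𝒜 (vW v) (decNil (sndF (vC v))) (vU v) < jOf 𝒜 (vW v))] := by
  simp [ltJF, fanoutFn_apply, kUF_apply, bitsToNat_ones_lt_iff]

/-- Value of `eqJF`. [folklore] -/
theorem eqJF_apply (v : List Bool) :
    eqJF 𝒜 v = [decide (kStar 𝒜 (vW v) (decNil (sndF (vC v))) (vU v) = jOf 𝒜 (vW v))] := by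
  simp [eqJF, fanoutFn_apply, kUF_apply, eqPairFn_boolPair]

/-- `ltJF ∈ FP`. [folklore] -/
theorem ltJF_mem_FP : ltJF 𝒜 ∈ FP :=
  comp_mem_FP ltFn_mem_FP (fanoutFn_mem_FP (kUF_mem_FP 𝒜) (comp_mem_FP (jUF_mem_FP 𝒜) fstF_mem_FP))

/-- `eqJF ∈ FP`. [folklore] -/
theorem eqJF_mem_FP : eqJF 𝒜 ∈ FP :=
  comp_mem_FP eqPairFn_mem_FP (fanoutFn_mem_FP (kUF_mem_FP 𝒜) (comp_mem_FP (jUF_mem_FP 𝒜) fstF_mem_FP))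

/-- `G` of the first half of the block. [folklore] -/
def gHalfF : List Bool → List Bool := G ∘ takeFn ∘ fanoutFn (nSF ∘ vW) (blkF 𝒜)

/-- **The value of the round**: `valL G n j s r_F k*`, selected by the two unary comparisons. [folklore] -/
def valF : List Bool → List Bool := iteFn (ltJF 𝒜) (blkF 𝒜) (iteFn (eqJF 𝒜) (sSF ∘ vW) (gHalfF 𝒜 G))

/-- **`valF v = valL G n j s r_F k*`.** [folklore] -/
theorem valF_apply (v : List Bool) :
    valF 𝒜 G v = valL G (nOf (vW v)) (jOf 𝒜 (vW v)) (sOf (vW v)) (rFOf 𝒜 (vW v))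
      (kStar 𝒜 (vW v) (decNil (sndF (vC v))) (vU v)) := by
  unfold valF valL
  by_cases h1 : kStar 𝒜 (vW v) (decNil (sndF (vC v))) (vU v) < jOf 𝒜 (vW v)
  · rw [iteFn_apply_true (by rw [ltJF_apply]; simp [h1]), if_pos h1, blkF_apply]
  · rw [iteFn_apply_false (by rw [ltJF_apply]; simp [h1]), if_neg h1]
    by_cases h2 : kStar 𝒜 (vW v) (decNil (sndF (vC v))) (vU v) = jOf 𝒜 (vW v)
    · rw [iteFn_apply_true (by rw [eqJF_apply]; simp [h2]), if_pos h2]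
      simp
    · rw [iteFn_apply_false (by rw [eqJF_apply]; simp [h2]), if_neg h2]
      simp [gHalfF, fanoutFn_apply, blkF_apply]

variable {G}

/-- `valF ∈ FP` for `G ∈ FP`. [folklore] -/
theorem valF_mem_FP (hG : G ∈ FP) : valF 𝒜 G ∈ FP :=
  iteFn_mem_FP (ltJF_mem_FP 𝒜) (blkF_mem_FP 𝒜) (iteFn_mem_FP (eqJF_mem_FP 𝒜) (comp_mem_FP sSF_mem_FP fstF_mem_FP)
    (comp_mem_FP hG (comp_mem_FP takeFn_mem_FP (fanoutFn_mem_FP (comp_mem_FP nSF_mem_FP fstF_mem_FP) (blkF_mem_FP 𝒜)))))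

variable (G)

/-- The bit `u[i]` selecting the child. [folklore] -/
def bitF : List Bool → List Bool := headBitFn ∘ bitAtFn ∘ fanoutFn (iUF 𝒜 ∘ vW) vU

/-- Value of the child bit. [folklore] -/
theorem bitF_apply (v : List Bool) : bitF 𝒜 v = [(vU v).getD (iOf 𝒜 (vW v)) false] := by
  simp only [bitF, Function.comp_apply, fanoutFn_apply, iUF_apply, bitAtFn_boolPair, headBitFn_apply]
  rw [show (ones (iOf 𝒜 (vW v))).length = iOf 𝒜 (vW v) by simp [ones], headD_take_one_drop]

/-- `bitF ∈ FP`. [folklore] -/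
theorem bitF_mem_FP : bitF 𝒜 ∈ FP :=
  comp_mem_FP headBitFn_mem_FP (comp_mem_FP bitAtFn_mem_FP
    (fanoutFn_mem_FP (comp_mem_FP (iUF_mem_FP 𝒜) fstF_mem_FP) (sndPow_mem_FP 1)))

/-- **The child label**: the half of the value selected by `u[i]`. [Goldreich 2001, p. 188 (`P_σ(α)`)] [folklore] -/
def childF : List Bool → List Bool :=
  iteFn (bitF 𝒜) (dropFn ∘ fanoutFn (nSF ∘ vW) (valF 𝒜 G)) (takeFn ∘ fanoutFn (nSF ∘ vW) (valF 𝒜 G))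

/-- Value of the child label. [folklore] -/
theorem childF_apply (v : List Bool) :
    childF 𝒜 G v = (if (vU v).getD (iOf 𝒜 (vW v)) false then (valF 𝒜 G v).drop (nOf (vW v))
      else (valF 𝒜 G v).take (nOf (vW v))) := by
  unfold childF
  rw [iteFn_apply (bitF_apply 𝒜 v)]
  split_ifs <;> simp [fanoutFn_apply]

variable {G}

/-- `childF ∈ FP`. [folklore] -/
theorem childF_mem_FP (hG : G ∈ FP) : childF 𝒜 G ∈ FP :=
  iteFn_mem_FP (bitF_mem_FP 𝒜) (comp_mem_FP dropFn_mem_FP (fanoutFn_mem_FP (comp_mem_FP nSF_mem_FP fstF_mem_FP) (valF_mem_FP 𝒜 hG)))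
    (comp_mem_FP takeFn_mem_FP (fanoutFn_mem_FP (comp_mem_FP nSF_mem_FP fstF_mem_FP) (valF_mem_FP 𝒜 hG)))

variable (G)

/-- **The walk from the child**: `ggmEval G child (u ⇂ (i+1))` by the machine of `GGM.lean`. [GGM 1986, §3.2] [folklore] -/
def ans0F : List Bool → List Bool :=
  GGM.evalFn G ∘ fanoutFn (fun _ => []) (fanoutFn (childF 𝒜 G)
    (dropFn ∘ fanoutFn (List.cons true ∘ iUF 𝒜 ∘ vW) vU))

/-- Value of the walk. [folklore] -/
theorem ans0F_apply (hG : ∀ s, (G s).length = 2 * s.length) (v : List Bool) :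
    ans0F 𝒜 G v = ggmEval G (childF 𝒜 G v) ((vU v).drop (iOf 𝒜 (vW v) + 1)) := by
  simp [ans0F, fanoutFn_apply, GGM.evalFn_apply hG, ones]

variable {G}

/-- `ans0F ∈ FP`. [folklore] -/
theorem ans0F_mem_FP (hG : G ∈ FP) : ans0F 𝒜 G ∈ FP :=
  comp_mem_FP (GGM.evalFn_mem_FP hG) (fanoutFn_mem_FP (const_mem_FP _) (fanoutFn_mem_FP (childF_mem_FP 𝒜 hG)
    (comp_mem_FP dropFn_mem_FP (fanoutFn_mem_FP
      (comp_mem_FP (cons_mem_FP true) (comp_mem_FP (iUF_mem_FP 𝒜) fstF_mem_FP)) (sndPow_mem_FP 1)))))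

variable (G)

/-- **The answer**: the walk on a valid query, `ε` on an invalid one. [folklore] -/
def ansF : List Bool → List Bool := iteFn (eqLenFn ∘ fanoutFn vU (nSF ∘ vW)) (ans0F 𝒜 G) (fun _ => [])

/-- **`ansF v = hAns w (decNil (sndF C)) u`.** [folklore] -/
theorem ansF_apply (hG : ∀ s, (G s).length = 2 * s.length) (v : List Bool) :
    ansF 𝒜 G v = hAns 𝒜 G (vW v) (decNil (sndF (vC v))) (vU v) := by
  unfold ansF hAns
  by_cases h : (vU v).length = nOf (vW v)
  · rw [iteFn_apply_true (by simp [fanoutFn_apply, h]), if_pos h, ans0F_apply 𝒜 G hG, childF_apply, valF_apply]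
    rfl
  · rw [iteFn_apply_false (by simp [fanoutFn_apply, h]), if_neg h]

variable {G}

/-- `ansF ∈ FP`. [folklore] -/
theorem ansF_mem_FP (hG : G ∈ FP) : ansF 𝒜 G ∈ FP :=
  iteFn_mem_FP (comp_mem_FP eqLenFn_mem_FP (fanoutFn_mem_FP (sndPow_mem_FP 1) (comp_mem_FP nSF_mem_FP fstF_mem_FP)))
    (ans0F_mem_FP 𝒜 hG) (const_mem_FP _)

variable (G)

/-- **The simulated oracle**: the answer followed by an echo of the query. [Goldreich 2001, p. 188;
GGM 1986, p. 801 (`A_T` answers the queries of `T`)] [folklore] -/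
def hOracle : List Bool → List Bool := fanoutFn (ansF 𝒜 G) vU

/-- **Value of the simulated oracle on every record.** [folklore] -/
theorem hOracle_apply (hG : ∀ s, (G s).length = 2 * s.length) (v : List Bool) :
    hOracle 𝒜 G v = boolPair (hAns 𝒜 G (fstF v) (decNil (sndF (nthF 1 v))) (sndPow 1 v)) (sndPow 1 v) := by
  rw [hOracle, fanoutFn_apply, ansF_apply 𝒜 G hG]
  rfl

/-- The simulated oracle on a genuine record `⟨w, ⟨listBool E', u⟩⟩`. [folklore] -/
theorem hOracle_record (hG : ∀ s, (G s).length = 2 * s.length) (w : List Bool) (E' : List (List Bool)) (u : List Bool) :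
    hOracle 𝒜 G (boolPair w (boolPair ((encodingList Bool).listBool.encode E') u)) = boolPair (hAns 𝒜 G w E' u) u := by
  have hid : E'.map (encodingList Bool).encode = E' := List.map_id E'
  rw [hOracle_apply 𝒜 G hG, listBool_encode_eq_encList, hid]
  simp [nthF, sndPow]

variable {G}

/-- **The simulated oracle is in `FP`** for `G ∈ FP`. [Goldreich 2001, p. 189 ("Clearly, algorithm `D`
can be implemented in polynomial time")] [folklore] -/
theorem hOracle_mem_FP (hG : G ∈ FP) : hOracle 𝒜 G ∈ FP := fanoutFn_mem_FP (ansF_mem_FP 𝒜 hG) (sndPow_mem_FP 1)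

end Oracle

/-! ### The simulator and its semantics (the echo invariant) -/

section Sim

/-- The adversary's input `⟨1ⁿ, r_A⟩` parsed from `w`, as a string function. [folklore] -/
def aInF : List Bool → List Bool := fanoutFn (onesFn ∘ nSF) (takeFn ∘ fanoutFn (cUF 𝒜) sndF)

/-- `aInF w = xAOf w`. [folklore] -/
@[simp] theorem aInF_apply (w : List Bool) : aInF 𝒜 w = xAOf 𝒜 w := by
  simp [aInF, xAOf, rAOf, fanoutFn_apply, onesFn, ones]

/-- `aInF ∈ FP`. [folklore] -/
theorem aInF_mem_FP : aInF 𝒜 ∈ FP :=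
  fanoutFn_mem_FP (comp_mem_FP onesFn_mem_FP nSF_mem_FP)
    (comp_mem_FP takeFn_mem_FP (fanoutFn_mem_FP (cUF_mem_FP 𝒜) sndF_mem_FP))

/-- The adversary clocked by its own round budget `fuel(|1ⁿ|)`. [Arora–Barak 2009, §3.4 with §1.4.1] [folklore] -/
def mc : OracleAlg Bool := 𝒜.alg.clockFst 𝒜.fuel false

/-- **The simulator**: the clocked adversary reading the first component of each answer, run on
`⟨1ⁿ, r_A⟩`, announcing input and transcript with each query. [Goldreich 2001, p. 188 ("algorithm
`D` invokes the oracle machine `M` on input `1ⁿ` and answers `M`'s queries as follows")] [folklore] -/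
def sim : OracleAlg Bool := (((mc 𝒜).mapAnswers fstF).comap (aInF 𝒜)).mapQuery id

/-- The step of the simulator. [folklore] -/
theorem sim_step (w : List Bool) (E' : List (List Bool)) :
    (sim 𝒜).step w E' = (match (mc 𝒜).step (xAOf 𝒜 w) (E'.map fstF) with
      | Sum.inl u => Sum.inl (boolPair w (boolPair ((encodingList Bool).listBool.encode E') u))
      | Sum.inr b => Sum.inr b) := by
  unfold sim
  rw [mapQuery_step, comap_step, mapAnswers_step, aInF_apply]
  cases (mc 𝒜).step (xAOf 𝒜 w) (E'.map fstF) <;> rfl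

/-- A first component is at most as long as the pair. [folklore] -/
theorem length_fstF_le (a : List Bool) : (fstF a).length ≤ a.length := by
  have := length_fstF_sndF_le a; omega

variable {𝒜}

/-- **The simulator is polynomial time** (toolkit: `isPolyTime_clockFst`, `isPolyTime_mapAnswers`,
`isPolyTime_comap`, `isPolyTime_mapQuery`). [Goldreich 2001, p. 189] [folklore] -/
theorem isPolyTime_sim (h𝒜 : 𝒜.IsPPT encodingBoolBool) : (sim 𝒜).IsPolyTime encodingBoolBool :=
  isPolyTime_mapQuery (eb := encodingBoolBool)
    (isPolyTime_comap (eb := encodingBoolBool)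
      (isPolyTime_mapAnswers (eb := encodingBoolBool) (isPolyTime_clockFst (eb := encodingBoolBool) h𝒜 _ _)
        fstF_mem_FP length_fstF_le)
      (aInF_mem_FP 𝒜))
    (PolyTimeComputable.id _)

variable (𝒜)

/-- **The echo transcript** of a plain transcript `E` of the rule-run on input `w`: item `k` is the
answer `E[k]` followed by the query of round `k` (recomputed by `OracleAlg.queryAt`). [folklore] -/
def echoR (w : List Bool) (E : List (List Bool)) : List (List Bool) :=
  (List.range E.length).map fun k => boolPair (E.getD k []) ((queryAt 𝒜.alg (xAOf 𝒜 w) E k).getD [])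

/-- One item per round. [folklore] -/
@[simp] theorem length_echoR (w : List Bool) (E : List (List Bool)) : (echoR 𝒜 w E).length = E.length := by
  simp [echoR]

/-- The first components of the echo transcript are the answers. [folklore] -/
theorem map_fstF_echoR (w : List Bool) (E : List (List Bool)) : (echoR 𝒜 w E).map fstF = E := by
  apply List.ext_getElem
  · simp [echoR]
  · intro k h1 h2
    simp [echoR, List.getD_eq_getElem?_getD, List.getElem?_eq_getElem h2]

/-- The items of the echo transcript. [folklore] -/
theorem getD_echoR (w : List Bool) (E : List (List Bool)) {k : ℕ} (hk : k < E.length) :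
    (echoR 𝒜 w E).getD k [] = boolPair (E.getD k []) ((queryAt 𝒜.alg (xAOf 𝒜 w) E k).getD []) := by
  rw [List.getD_eq_getElem?_getD, echoR, List.getElem?_map, List.getElem?_range hk]
  rfl

/-- One more answered round appends one echo item. [folklore] -/
theorem echoR_append_singleton (w : List Bool) {E : List (List Bool)} {u : List Bool} (a : List Bool)
    (hstep : 𝒜.alg.step (xAOf 𝒜 w) E = Sum.inl u) : echoR 𝒜 w (E ++ [a]) = echoR 𝒜 w E ++ [boolPair a u] := by
  unfold echoR
  rw [List.length_append, List.length_singleton, List.range_succ, List.map_append, List.map_singleton]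
  congr 1
  · refine List.map_congr_left fun k hk => ?_
    rw [List.mem_range] at hk
    rw [List.getD_eq_getElem?_getD, List.getD_eq_getElem?_getD, List.getElem?_append_left hk,
      queryAt_of_prefix 𝒜.alg (xAOf 𝒜 w) (List.prefix_append E [a]) hk.le]
  · rw [List.getD_eq_getElem?_getD, List.getElem?_append_right le_rfl, Nat.sub_self, List.getElem?_singleton]
    have hq : queryAt 𝒜.alg (xAOf 𝒜 w) (E ++ [a]) E.length = some u := by
      unfold queryAt; rw [List.take_left' rfl, hstep]
    simp [hq]

/-- The first matching index as a search over positions. [folklore] -/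
theorem findIdx_eq_getD_find?_range {α : Type} (p : α → Bool) (d : α) :
    ∀ l : List α, l.findIdx p = ((List.range l.length).find? fun k => p (l.getD k d)).getD l.length
  | [] => by simp
  | a :: l => by
    rw [List.findIdx_cons, List.length_cons, List.range_succ_eq_map, List.find?_cons]
    have h0 : (a :: l).getD 0 d = a := rfl
    rw [h0]
    cases ha : p a
    · simp only [cond_false]
      rw [List.find?_map, findIdx_eq_getD_find?_range p d l]
      simp only [Function.comp_def, Nat.succ_eq_add_one, List.getD_cons_succ]
      cases (List.range l.length).find? (fun k => p (l.getD k d)) <;> simp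
    · simp

/-- Two searches over the same positions with pointwise equal tests agree. [folklore] -/
theorem find?_range_congr {p q : ℕ → Bool} {m : ℕ} (h : ∀ k < m, p k = q k) :
    (List.range m).find? p = (List.range m).find? q := by
  have : ∀ (l : List ℕ), (∀ k ∈ l, p k = q k) → l.find? p = l.find? q := by
    intro l hl
    induction l with
    | nil => rfl
    | cons a l ih => rw [List.find?_cons, List.find?_cons, hl a (by simp), ih fun b hb => hl b (by simp [hb])]
  exact this _ fun k hk => h k (List.mem_range.1 hk)

/-- The level never exceeds the key length: `iOf w ≤ nOf w`. [folklore] -/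
theorem iOf_le_nOf (w : List Bool) : iOf 𝒜 w ≤ nOf w := min_le_right _ _

/-- **On the echo transcript the oracle's scan is the first-round device `firstIdx`** of the
specification (along transcripts all of whose rounds queried). [Goldreich 2001, p. 189] [folklore] -/
theorem kStar_echoR (w : List Bool) {E : List (List Bool)} (hq : ∀ m < E.length, ∃ q, queryAt 𝒜.alg (xAOf 𝒜 w) E m = some q)
    {u : List Bool} {κ : List.Vector Bool (iOf 𝒜 w)} (hκ : keyAt (nOf w) (iOf 𝒜 w) u = some κ) :
    kStar 𝒜 w (echoR 𝒜 w E) u = (firstIdx 𝒜.alg (xAOf 𝒜 w) (keyAt (nOf w) (iOf 𝒜 w)) E κ).getD E.length := by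
  classical
  unfold kStar firstIdx
  rw [findIdx_eq_getD_find?_range (matchE 𝒜 w u) [], length_echoR]
  congr 1
  refine find?_range_congr fun k hk => ?_
  obtain ⟨q, hqk⟩ := hq k hk
  rw [getD_echoR 𝒜 w E hk, hqk]
  have hu := length_eq_of_keyAt_eq_some (nOf w) hκ
  have hκ' := keyAt_of_length_eq (nOf w) (iOf_le_nOf 𝒜 w) hu.1
  rw [hκ] at hκ'
  have hκv : κ.toList = u.take (iOf 𝒜 w) := by rw [Option.some_injective _ hκ']; rfl
  simp only [matchE, Option.getD_some, sndF_boolPair, keyAtRound, hqk, Option.bind_some, decide_eq_decide]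
  constructor
  · rintro ⟨h1, h2⟩
    rw [keyAt_of_length_eq (nOf w) (iOf_le_nOf 𝒜 w) h1]
    congr 1
    exact List.Vector.eq _ _ (by rw [hκv]; exact h2)
  · intro h
    have hql := length_eq_of_keyAt_eq_some (nOf w) h
    refine ⟨hql.1, ?_⟩
    rw [keyAt_of_length_eq (nOf w) (iOf_le_nOf 𝒜 w) hql.1] at h
    have := congrArg List.Vector.toList (Option.some_injective _ h)
    rw [hκv] at this
    exact this

/-- **The oracle's answer on the echo transcript is the specified rule** `simRule`. [folklore] -/
theorem hAns_echoR (w : List Bool) {E : List (List Bool)} (hq : ∀ m < E.length, ∃ q, queryAt 𝒜.alg (xAOf 𝒜 w) E m = some q)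
    (u : List Bool) : hAns 𝒜 G w (echoR 𝒜 w E) u = simRule 𝒜 G w E u := by
  unfold hAns simRule lazyRule
  by_cases hu : u.length = nOf w
  · rw [if_pos hu, keyAt_of_length_eq (nOf w) (iOf_le_nOf 𝒜 w) hu]
    simp only
    rw [kStar_echoR 𝒜 w hq (keyAt_of_length_eq (nOf w) (iOf_le_nOf 𝒜 w) hu)]
  · rw [if_neg hu]
    unfold keyAt
    rw [dif_neg (fun h => hu h.1)]

/-- The clocked adversary queries only within the adversary's budget, and then asks what the
adversary asks. [folklore] -/
theorem mc_step_eq_inl {w : List Bool} {E : List (List Bool)} {u : List Bool}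
    (h : (mc 𝒜).step (xAOf 𝒜 w) E = Sum.inl u) : E.length < tA 𝒜 (nOf w) ∧ 𝒜.alg.step (xAOf 𝒜 w) E = Sum.inl u := by
  unfold mc at h
  rw [clockFst_step] at h
  have hlen : (boolUnpair (xAOf 𝒜 w)).1.length = nOf w := by
    simp [xAOf, length_unaryEncodeNat_eq]
  rw [hlen] at h
  by_cases hc : E.length < 𝒜.fuel.eval (nOf w)
  · rw [if_pos hc] at h; exact ⟨hc, h⟩
  · rw [if_neg hc] at h; exact absurd h (by simp)

/-- **Semantics of the simulator**: against the simulated oracle, from the echo transcript of a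
plain transcript all of whose rounds queried, the simulator runs as the rule-run of the clocked
adversary under `simRule`. [Goldreich 2001, p. 188–189] [folklore] -/
theorem runAux_sim (hG : ∀ s, (G s).length = 2 * s.length) (w : List Bool) :
    ∀ (k : ℕ) (E : List (List Bool)), (∀ m < E.length, ∃ q, queryAt 𝒜.alg (xAOf 𝒜 w) E m = some q) →
      (sim 𝒜).runAux (hOracle 𝒜 G) w k (echoR 𝒜 w E) = runRule (mc 𝒜) (xAOf 𝒜 w) (simRule 𝒜 G w) k E
  | 0, _, _ => rfl
  | k + 1, E, hq => by
    rw [runAux_succ, sim_step, map_fstF_echoR, runRule_succ]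
    cases hs : (mc 𝒜).step (xAOf 𝒜 w) E with
    | inr b => rfl
    | inl u =>
      have hA := (mc_step_eq_inl 𝒜 hs).2
      simp only
      rw [hOracle_record 𝒜 G hG, hAns_echoR 𝒜 G w hq, ← echoR_append_singleton 𝒜 w _ hA]
      refine runAux_sim hG w k _ fun m hm => ?_
      rw [List.length_append, List.length_singleton] at hm
      rcases Nat.lt_succ_iff_lt_or_eq.1 hm with hm | rfl
      · obtain ⟨q, hq'⟩ := hq m hm
        exact ⟨q, by rw [queryAt_of_prefix 𝒜.alg _ (List.prefix_append E _) hm.le, hq']⟩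
      · exact ⟨u, by unfold queryAt; rw [List.take_left' rfl, hA]⟩

/-- **The simulator's run** from the empty transcript. [folklore] -/
theorem run_sim (hG : ∀ s, (G s).length = 2 * s.length) (w : List Bool) (k : ℕ) :
    (sim 𝒜).run (hOracle 𝒜 G) k w = runRule (mc 𝒜) (xAOf 𝒜 w) (simRule 𝒜 G w) k [] :=
  runAux_sim 𝒜 G hG w k [] (by simp)

/-- **The simulator computes the verdict of the specification**: with more rounds than the
adversary's budget it outputs whether the `fuel(n)`-round rule-run of the adversary accepts.
[Goldreich 2001, p. 188] [folklore] -/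
theorem run_sim_eq (hG : ∀ s, (G s).length = 2 * s.length) (w : List Bool) {k : ℕ} (hk : tA 𝒜 (nOf w) < k) :
    (sim 𝒜).run (hOracle 𝒜 G) k w =
      some ((runRule 𝒜.alg (xAOf 𝒜 w) (simRule 𝒜 G w) (tA 𝒜 (nOf w)) []).getD false) := by
  rw [run_sim 𝒜 G hG]
  unfold mc clockFst
  have hlen : ∀ x : List Bool, x = xAOf 𝒜 w → 𝒜.fuel.eval (boolUnpair x).1.length = tA 𝒜 (nOf w) := by
    rintro x rfl; simp [xAOf, length_unaryEncodeNat_eq, tA]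
  rw [runRule_clockBy _ _ _ _ _ k [] (Nat.zero_le _) (by rw [hlen _ rfl]; simpa using hk), hlen _ rfl]
  rfl

end Sim

/-! ### Size bounds along the simulator's run -/

section Bounds

variable {G}

/-- **The simulated answers are short**: at most `n` symbols (a label, or `ε`). [folklore] -/
theorem length_postPairL_valL_le (hG : ∀ s, (G s).length = 2 * s.length) (w : List Bool) (k : ℕ) (u : List Bool) :
    (postPairL G (nOf w) (iOf 𝒜 w) (valL G (nOf w) (jOf 𝒜 w) (sOf w) (rFOf 𝒜 w) k) u).length ≤ nOf w := by
  have hv : (valL G (nOf w) (jOf 𝒜 w) (sOf w) (rFOf 𝒜 w) k).length ≤ 2 * nOf w := by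
    unfold valL
    split_ifs
    · unfold blkL; exact (List.length_take_le _ _)
    · unfold sOf; exact (List.length_take_le _ _)
    · rw [hG, List.length_take]; omega
  unfold postPairL
  rw [length_ggmEval hG]
  split_ifs
  · rw [List.length_drop]; omega
  · rw [List.length_take]; omega

/-- The rule's answers are short. [folklore] -/
theorem length_simRule_le (hG : ∀ s, (G s).length = 2 * s.length) (w : List Bool) (E : List (List Bool)) (u : List Bool) :
    (simRule 𝒜 G w E u).length ≤ nOf w := by
  unfold simRule lazyRule
  cases keyAt (nOf w) (iOf 𝒜 w) u with
  | none => exact Nat.zero_le _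
  | some κ => exact length_postPairL_valL_le 𝒜 hG w _ u

variable (G)

/-- `n ≤ |w|`. [folklore] -/
theorem nOf_le_length (w : List Bool) : nOf w ≤ w.length :=
  (length_fstF_le (fstF w)).trans (length_fstF_le w)

/-- `|⟨1ⁿ, r_A⟩| ≤ 2n + 2 + coins(n)`. [folklore] -/
theorem length_xAOf_le (w : List Bool) : (xAOf 𝒜 w).length ≤ 2 * nOf w + 2 + cA 𝒜 (nOf w) := by
  unfold xAOf rAOf
  rw [length_boolPair, length_unaryEncodeNat_eq]
  have := List.length_take_le (cA 𝒜 (nOf w)) (sndF w)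
  omega

/-- The code of a transcript of at most `t` answers of length at most `n` has length at most
`2t + 2 + t(2n+2)`. [folklore] -/
theorem length_listBool_encode_le {E : List (List Bool)} {t n : ℕ} (ht : E.length ≤ t) (hn : ∀ a ∈ E, a.length ≤ n) :
    ((encodingList Bool).listBool.encode E).length ≤ 2 * t + 2 + t * (2 * n + 2) := by
  rw [OracleComposition.length_listBool_encode]
  have h1 := OracleComposition.sum_map_le_length_mul E (fun a => 2 * a.length + 2) (2 * n + 2)
    (fun a ha => by have := hn a ha; omega)
  have h2 : E.length * (2 * n + 2) ≤ t * (2 * n + 2) := Nat.mul_le_mul_right _ ht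
  omega

/-- **The adversary's queries are short** along transcripts of at most `t` short answers: the
payload of the step code is bounded by the output-length polynomial `R` of the step function.
[Arora–Barak 2009, §3.4 (a polynomial-time machine asks polynomially long queries)] [folklore] -/
theorem length_query_le {R : Polynomial ℕ}
    (hR : ∀ (x : List Bool) (ans : List (List Bool)),
      (((encodingList Bool).sumBool encodingBoolBool).encode (𝒜.alg.step x ans)).length ≤
        R.eval (boolPair x ((encodingList Bool).listBool.encode ans)).length)
    (w : List Bool) {E : List (List Bool)} (ht : E.length ≤ tA 𝒜 (nOf w)) (hn : ∀ a ∈ E, a.length ≤ nOf w)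
    {u : List Bool} (hs : 𝒜.alg.step (xAOf 𝒜 w) E = Sum.inl u) :
    u.length + 1 ≤ R.eval (2 * (2 * nOf w + 2 + cA 𝒜 (nOf w)) + 2 + (2 * tA 𝒜 (nOf w) + 2 + tA 𝒜 (nOf w) * (2 * nOf w + 2))) := by
  have h1 := hR (xAOf 𝒜 w) E
  rw [hs] at h1
  have h2 : (((encodingList Bool).sumBool encodingBoolBool).encode (Sum.inl u : List Bool ⊕ Bool)).length = u.length + 1 := rfl
  rw [h2] at h1
  refine h1.trans (TM2Iter.eval_mono R ?_)
  rw [length_boolPair]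
  have h3 := length_xAOf_le 𝒜 w
  have h4 := length_listBool_encode_le ht hn
  omega

/-- **The size of a query record** `⟨w, ⟨listBool E', u⟩⟩` with `|E'| ≤ t` items of size `≤ F` and
`|u| ≤ K`. [folklore] -/
theorem length_record_le (w : List Bool) {E' : List (List Bool)} {t F K : ℕ} (ht : E'.length ≤ t)
    (hF : ∀ e ∈ E', e.length ≤ F) {u : List Bool} (hu : u.length ≤ K) :
    (boolPair w (boolPair ((encodingList Bool).listBool.encode E') u)).length ≤
      2 * w.length + 2 + (2 * (2 * t + 2 + t * (2 * F + 2)) + 2 + K) := by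
  rw [length_boolPair, length_boolPair, OracleComposition.length_listBool_encode]
  have h1 := OracleComposition.sum_map_le_length_mul E' (fun a => 2 * a.length + 2) (2 * F + 2)
    (fun a ha => by have := hF a ha; omega)
  have h2 : E'.length * (2 * F + 2) ≤ t * (2 * F + 2) := Nat.mul_le_mul_right _ ht
  omega

/-- The items of an echo transcript are short when the answers and the recorded queries are. [folklore] -/
theorem length_item_echoR_le (w : List Bool) {E : List (List Bool)} {n K : ℕ} (hn : ∀ a ∈ E, a.length ≤ n)
    (hq : ∀ m < E.length, ∃ q, queryAt 𝒜.alg (xAOf 𝒜 w) E m = some q ∧ q.length ≤ K) :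
    ∀ e ∈ echoR 𝒜 w E, e.length ≤ 2 * n + 2 + K := by
  intro e he
  unfold echoR at he
  rw [List.mem_map] at he
  obtain ⟨m, hm, rfl⟩ := he
  rw [List.mem_range] at hm
  obtain ⟨q, hqm, hqK⟩ := hq m hm
  rw [hqm, length_boolPair]
  have ha : (E.getD m []).length ≤ n := by
    rw [List.getD_eq_getElem?_getD, List.getElem?_eq_getElem hm]
    exact hn _ (List.getElem_mem hm)
  simp only [Option.getD_some]
  omega

/-- **All query records of the simulator's run are short**: along the run from the echo
transcript of `E` (rounds all queried with queries of length `≤ K`, answers of length `≤ n`,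
`|E| ≤ t`), every record has length at most `2|w| + 2 + (2(2t + 2 + t(2(2n+2+K)+2)) + 2 + K)`.
[folklore] -/
theorem length_query_sim (hG : ∀ s, (G s).length = 2 * s.length) (w : List Bool) {K : ℕ}
    (hK : ∀ (E : List (List Bool)) (u : List Bool), E.length ≤ tA 𝒜 (nOf w) → (∀ a ∈ E, a.length ≤ nOf w) →
      𝒜.alg.step (xAOf 𝒜 w) E = Sum.inl u → u.length ≤ K) :
    ∀ (k : ℕ) (E : List (List Bool)),
      (∀ m < E.length, ∃ q, queryAt 𝒜.alg (xAOf 𝒜 w) E m = some q ∧ q.length ≤ K) →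
      (∀ a ∈ E, a.length ≤ nOf w) → E.length ≤ tA 𝒜 (nOf w) →
      ∀ v ∈ (sim 𝒜).queriesAux (hOracle 𝒜 G) w k (echoR 𝒜 w E),
        v.length ≤ 2 * w.length + 2 +
          (2 * (2 * tA 𝒜 (nOf w) + 2 + tA 𝒜 (nOf w) * (2 * (2 * nOf w + 2 + K) + 2)) + 2 + K)
  | 0, _, _, _, _, v, hv => by simp [queriesAux] at hv
  | k + 1, E, hq, hn, ht, v, hv => by
    unfold queriesAux at hv
    rw [sim_step, map_fstF_echoR] at hv
    cases hs : (mc 𝒜).step (xAOf 𝒜 w) E with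
    | inr b => rw [hs] at hv; simp at hv
    | inl u =>
      rw [hs] at hv
      obtain ⟨hlt, hA⟩ := mc_step_eq_inl 𝒜 hs
      have hu : u.length ≤ K := hK E u ht hn hA
      simp only [List.mem_cons] at hv
      rcases hv with rfl | hv
      · exact length_record_le w (by rw [length_echoR]; exact ht) (length_item_echoR_le 𝒜 w hn hq) hu
      · rw [hOracle_record 𝒜 G hG, hAns_echoR 𝒜 G w (fun m hm => (hq m hm).imp fun q h => h.1),
          ← echoR_append_singleton 𝒜 w _ hA] at hv
        refine length_query_sim hG w hK k _ (fun m hm => ?_) (fun a ha => ?_) ?_ v hv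
        · rw [List.length_append, List.length_singleton] at hm
          rcases Nat.lt_succ_iff_lt_or_eq.1 hm with hm | rfl
          · obtain ⟨q, hq', hqK⟩ := hq m hm
            exact ⟨q, by rw [queryAt_of_prefix 𝒜.alg _ (List.prefix_append E _) hm.le, hq'], hqK⟩
          · exact ⟨u, by unfold queryAt; rw [List.take_left' rfl, hA], hu⟩
        · rcases List.mem_append.1 ha with ha | ha
          · exact hn a ha
          · rw [List.mem_singleton] at ha
            rw [ha]
            exact length_simRule_le 𝒜 hG w E u
        · rw [List.length_append, List.length_singleton]
          exact hlt

end Bounds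

/-! ### The simulation language is in `P` -/

section InP

/-- The argument of the output-length polynomial, bounded in `L = |w|`:
`2(2L + 2 + coins(L)) + 2 + 2 fuel(L) + 2 + fuel(L)(2L + 2)`. [folklore] -/
def argPoly : Polynomial ℕ :=
  C 2 * (C 2 * X + C 2 + 𝒜.coins) + C 2 + (C 2 * 𝒜.fuel + C 2 + 𝒜.fuel * (C 2 * X + C 2))

/-- Value of `argPoly`. [folklore] -/
theorem argPoly_eval (L : ℕ) :
    (argPoly 𝒜).eval L = 2 * (2 * L + 2 + 𝒜.coins.eval L) + 2 + (2 * 𝒜.fuel.eval L + 2 + 𝒜.fuel.eval L * (2 * L + 2)) := by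
  simp [argPoly]

/-- The query-length bound `K(L) = R(argPoly(L))`. [folklore] -/
def kPoly (R : Polynomial ℕ) : Polynomial ℕ := R.comp (argPoly 𝒜)

/-- The record-length bound `Q(L)`. [folklore] -/
def qPoly (R : Polynomial ℕ) : Polynomial ℕ :=
  C 2 * X + C 2 + (C 2 * (C 2 * 𝒜.fuel + C 2 + 𝒜.fuel * (C 2 * (C 2 * X + C 2 + kPoly 𝒜 R) + C 2)) + C 2 + kPoly 𝒜 R)

/-- Value of `qPoly`. [folklore] -/
theorem qPoly_eval (R : Polynomial ℕ) (L : ℕ) :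
    (qPoly 𝒜 R).eval L = 2 * L + 2 +
      (2 * (2 * 𝒜.fuel.eval L + 2 + 𝒜.fuel.eval L * (2 * (2 * L + 2 + (kPoly 𝒜 R).eval L) + 2)) + 2 + (kPoly 𝒜 R).eval L) := by
  simp [qPoly]

/-- **The round-and-query polynomial of the simulator**: `Q + fuel + 1`. [folklore] -/
def simPolyGGM (R : Polynomial ℕ) : Polynomial ℕ := qPoly 𝒜 R + 𝒜.fuel + C 1

variable {𝒜 G}

/-- **The simulation language is in `P` relative to the simulated oracle** (machine `sim`,
polynomial `simPolyGGM`). [Goldreich 2001, p. 189] [folklore] -/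
theorem simLang_mem_PRel (h𝒜 : 𝒜.IsPPT encodingBoolBool) (hG : ∀ s, (G s).length = 2 * s.length) :
    simLang 𝒜 G ∈ PRel (hOracle 𝒜 G) := by
  obtain ⟨R, hR⟩ := OracleAlg.IsPolyTime.exists_length_le h𝒜
  refine ⟨sim 𝒜, isPolyTime_sim h𝒜, simPolyGGM 𝒜 R, fun w => ?_⟩
  have hnL : nOf w ≤ w.length := nOf_le_length w
  have hcL : cA 𝒜 (nOf w) ≤ 𝒜.coins.eval w.length := TM2Iter.eval_mono _ hnL
  have htL : tA 𝒜 (nOf w) ≤ 𝒜.fuel.eval w.length := TM2Iter.eval_mono _ hnL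
  -- the query-length bound
  have hK : ∀ (E : List (List Bool)) (u : List Bool), E.length ≤ tA 𝒜 (nOf w) → (∀ a ∈ E, a.length ≤ nOf w) →
      𝒜.alg.step (xAOf 𝒜 w) E = Sum.inl u → u.length ≤ (kPoly 𝒜 R).eval w.length := by
    intro E u ht hnE hs
    have h1 := length_query_le 𝒜 hR w ht hnE hs
    have h2 : 2 * (2 * nOf w + 2 + cA 𝒜 (nOf w)) + 2 + (2 * tA 𝒜 (nOf w) + 2 + tA 𝒜 (nOf w) * (2 * nOf w + 2)) ≤
        (argPoly 𝒜).eval w.length := by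
      rw [argPoly_eval]
      have : tA 𝒜 (nOf w) * (2 * nOf w + 2) ≤ 𝒜.fuel.eval w.length * (2 * w.length + 2) :=
        Nat.mul_le_mul htL (by omega)
      omega
    have h3 := TM2Iter.eval_mono R h2
    rw [kPoly, eval_comp]
    omega
  have hfuel : tA 𝒜 (nOf w) < (simPolyGGM 𝒜 R).eval w.length := by
    simp only [simPolyGGM, eval_add, eval_C]
    omega
  constructor
  · rw [run_sim_eq 𝒜 G hG w hfuel]
    congr 1
    rw [Bool.eq_iff_iff, ← Set.mem_iff_boolIndicator]
    show _ ↔ runRule 𝒜.alg (xAOf 𝒜 w) (simRule 𝒜 G w) (tA 𝒜 (nOf w)) [] = some true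
    cases runRule 𝒜.alg (xAOf 𝒜 w) (simRule 𝒜 G w) (tA 𝒜 (nOf w)) [] with
    | none => simp
    | some b => cases b <;> simp
  · intro v hv
    have hb := length_query_sim 𝒜 G hG w hK ((simPolyGGM 𝒜 R).eval w.length) [] (by simp) (by simp)
      (Nat.zero_le _) v hv
    refine hb.trans ?_
    have hKK : tA 𝒜 (nOf w) * (2 * (2 * nOf w + 2 + (kPoly 𝒜 R).eval w.length) + 2) ≤
        𝒜.fuel.eval w.length * (2 * (2 * w.length + 2 + (kPoly 𝒜 R).eval w.length) + 2) :=
      Nat.mul_le_mul htL (by omega)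
    simp only [simPolyGGM, eval_add, eval_C, qPoly_eval]
    omega

/-- **The simulation language is in `P`**: `P^{hOracle} ⊆ P^{FP^∅} ⊆ P^∅ = P`
(`OracleAlg.PRel_subset_PRel_of_mem_FPRel`, `PRel_empty_holds`). [Goldreich 2001, p. 189 ("Clearly,
algorithm `D` can be implemented in polynomial time")] [folklore] -/
theorem simLang_mem_P (h𝒜 : 𝒜.IsPPT encodingBoolBool) (hGc : G ∈ FP) (hG : ∀ s, (G s).length = 2 * s.length) :
    simLang 𝒜 G ∈ Classes.P := by
  have h1 := simLang_mem_PRel h𝒜 hG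
  have h2 : hOracle 𝒜 G ∈ FPRel Oracle.empty := FP_subset_FPRel_core _ (hOracle_mem_FP 𝒜 hGc)
  have h3 := PRel_subset_PRel_of_mem_FPRel h2 h1
  have h4 := PRel_empty_holds
  unfold PRel_empty at h4
  rwa [h4] at h3

end InP

/-! ### The distinguisher is PPT -/

section PPT

/-- **The guard** `[i < n ∧ j < t]` as a one-bit brick (unary comparisons by value). [folklore] -/
def guardF : List Bool → List Bool :=
  andFn (ltFn ∘ fanoutFn (iUF 𝒜) (onesFn ∘ nSF)) (ltFn ∘ fanoutFn (jUF 𝒜) (tUF 𝒜))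

/-- Value of the guard. [folklore] -/
theorem guardF_apply (w : List Bool) :
    guardF 𝒜 w = [decide (iOf 𝒜 w < nOf w) && decide (jOf 𝒜 w < tA 𝒜 (nOf w))] := by
  unfold guardF
  refine andFn_apply ?_ ?_
  · simp [fanoutFn_apply, onesFn, OracleCompose.unaryEncodeNat_eq_replicate, bitsToNat_ones_lt_iff]
  · simp [fanoutFn_apply, bitsToNat_ones_lt_iff]

/-- `guardF ∈ FP`. [folklore] -/
theorem guardF_mem_FP : guardF 𝒜 ∈ FP :=
  andFn_mem_FP (comp_mem_FP ltFn_mem_FP (fanoutFn_mem_FP (iUF_mem_FP 𝒜) (comp_mem_FP onesFn_mem_FP nSF_mem_FP)))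
    (comp_mem_FP ltFn_mem_FP (fanoutFn_mem_FP (jUF_mem_FP 𝒜) (tUF_mem_FP 𝒜)))

/-- The indicator of the simulation language as a one-symbol string function. [folklore] -/
def indF : List Bool → List Bool := fun w => encodeBool ((simLang 𝒜 G).boolIndicator w)

variable {𝒜 G}

/-- **The indicator of the simulation language is in `FP`** (the language is in `P`). [folklore] -/
theorem indF_mem_FP (h𝒜 : 𝒜.IsPPT encodingBoolBool) (hGc : G ∈ FP) (hG : ∀ s, (G s).length = 2 * s.length) :
    indF 𝒜 G ∈ FP := by
  have h := mem_P_iff_holds.1 (simLang_mem_P h𝒜 hGc hG)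
  rw [polyTimeDecidable_iff] at h
  exact PolyTimeComputable.of_encode_eq (f := (simLang 𝒜 G).boolIndicator) (f' := indF 𝒜 G) id
    (fun _ => rfl) (fun _ => rfl) h

variable (𝒜 G)

/-- **The verdict as a string function**: guard AND indicator. [folklore] -/
def accF : List Bool → List Bool := andFn (guardF 𝒜) (indF 𝒜 G)

/-- **`accF w = [simAccept w]`.** [folklore] -/
theorem accF_apply (w : List Bool) : accF 𝒜 G w = encodeBool (simAccept 𝒜 G w) := by
  classical
  unfold accF
  rw [andFn_apply (guardF_apply 𝒜 w) (show indF 𝒜 G w = [(simLang 𝒜 G).boolIndicator w] from rfl)]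
  show [_] = [_]
  congr 1
  rw [Bool.eq_iff_iff]
  unfold simAccept
  rw [decide_eq_true_iff, Bool.and_eq_true, Bool.and_eq_true, decide_eq_true_iff, decide_eq_true_iff,
    ← Set.mem_iff_boolIndicator]
  tauto

variable {𝒜 G}

/-- `accF ∈ FP`. [folklore] -/
theorem accF_mem_FP (h𝒜 : 𝒜.IsPPT encodingBoolBool) (hGc : G ∈ FP) (hG : ∀ s, (G s).length = 2 * s.length) :
    accF 𝒜 G ∈ FP :=
  andFn_mem_FP (guardF_mem_FP 𝒜) (indF_mem_FP h𝒜 hGc hG)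

/-- `⌊log₂ m⌋ + 1 ≤ m + 1`. [folklore] -/
theorem alphaOf_le (m : ℕ) : alphaOf m ≤ m + 1 := by
  unfold alphaOf
  have := Nat.log_le_self 2 m
  omega

variable (𝒜 G)

/-- **The distinguisher `D` is probabilistic polynomial-time**: its verdict `⟨x, r⟩ ↦ simAccept ⟨x, r⟩`
is the `FP` function `accF` read through the pair presentation, and its coin budget
`coins(n) + α + β + 2nt` is bounded by the polynomial `coins + (X + 1) + (fuel + 1) + 2·X·fuel`.
[Goldreich 2001, p. 189 ("Clearly, algorithm `D` can be implemented in polynomial time");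
GGM 1986, p. 801] [folklore] -/
theorem distinguisher_isPPT (h𝒜 : 𝒜.IsPPT encodingBoolBool)
    (hGc : PolyTimeComputable (id : List Bool → List Bool) (id : List Bool → List Bool) G)
    (hG : ∀ s, (G s).length = 2 * s.length) : IsPPT (distinguisher 𝒜 G) encodeBool := by
  refine ⟨?_, ?_⟩
  · exact PolyTimeComputable.of_encode_eq (f := accF 𝒜 G) (f' := Function.uncurry (distinguisher 𝒜 G).run)
      (fun p : List Bool × List Bool => boolPair p.1 p.2) (fun _ => rfl) (fun p => accF_apply 𝒜 G _)
      (accF_mem_FP h𝒜 hGc hG)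
  · refine ⟨𝒜.coins + (X + 1) + (𝒜.fuel + 1) + 2 * X * 𝒜.fuel, fun L => ?_⟩
    show coinLenD 𝒜 L ≤ _
    unfold coinLenD
    have hn : (L - 2) / 4 ≤ L := (Nat.div_le_self _ _).trans (Nat.sub_le _ _)
    have hc : cA 𝒜 ((L - 2) / 4) ≤ 𝒜.coins.eval L := TM2Iter.eval_mono _ hn
    have ht : tA 𝒜 ((L - 2) / 4) ≤ 𝒜.fuel.eval L := TM2Iter.eval_mono _ hn
    have ha := alphaOf_le ((L - 2) / 4)
    have hb : betaOf (tA 𝒜 ((L - 2) / 4)) ≤ 𝒜.fuel.eval L + 1 := (alphaOf_le _).trans (by omega)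
    have hm : 2 * ((L - 2) / 4) * tA 𝒜 ((L - 2) / 4) ≤ 2 * L * 𝒜.fuel.eval L :=
      Nat.mul_le_mul (Nat.mul_le_mul_left 2 hn) ht
    simp only [eval_add, eval_mul, eval_X, eval_one, eval_ofNat]
    omega

end PPT

end GGMHyb

end Literature.Computability.Cryptography
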